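import Summits.ABC.IUTFork.Conditional.AbcOfSSharpLevelCutJunction
import Summits.ABC.IUTFork.Cor312SlotLicenceNormConstKDegOne
import HarnessLib

/-!
# Branch C / R-W, reading (P): the PER-IMAGE Corollary and the SLOT licence at EVERY genuine Θ-datum of EVERY abc triple beyond the SHARP
# level — the reading-(P) analogue of «C:COR312U-EVENTUAL» v2, at a level POLYNOMIAL in `abc` (abc-iut cell, branch C, row «C-LEVELCUT-SHARP»,
# optional second target; seat abc-iut-C-cert-2 gen 7)

Record-only PROOF file (D-0012; 0 definitions, 0 `Prop` facts, nothing re-typed) of the abc-iut cell. TAKES NO SIDE on [IUTchIII] Cor. 3.12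
(S. Mochizuki, *Inter-universal Teichmüller theory III*, Cor. 3.12 p. 173–174; Step (xi-f) p. 184), on (U)/(P), or on any author.

THE QUESTION (C lead, KEY C-LEVELCUT-SHARP): the reading-(P) eventual theorems of the tree — abc-iut-c312-d1's
`cor312PerImageOf_of_degree_le_of_log_le` and this seat's `Cor22.cor312PerImageOf_of_exp_le` (p497791) — need `log l ≥ (2/3)·d·log q^{∤2}(λ)`, a
level EXPONENTIAL in the height; can a level POLYNOMIAL in `abc` serve the per-image Corollary at degree-1 points? ANSWER (numbers, not
adjectives): YES at the Frey point `λ = a/c` of every abc triple with `j(a/c) ≠ 1728`, at every prime `l ≥ 5` with `p < l ∧ 4·p^{⌊v_p(abc)/2⌋} < l`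
for every odd prime `p ∣ abc` — in particular at every prime `l ≥ 4·Nat.sqrt(abc) + 5` — but NOT because the hull licence would imply the
per-image inequality: because there `d_mod = 1` (`F_mod = ℚ`, ONE place over each prime), where OUR typed per-image Corollary IS the (U) one
(abc-iut-c312-d1 `DHData.cor312Of_iff_perImage_of_finrank_eq_one`) and OUR slot licence IS the (U) licence for realising ideles (abc-iut-c312-d1 /
gen 4 `Cor312Prov.slotLicence_iff_licence_settingPrVolSharp_pilotDataOfK_of_finrank_eq_one_of_isVolumeInputOf`), and p508140 supplies the (U)
statements. Outside this locus (degree `≥ 2`, `j = 1728`, `λ ∉ (0,1)`) nothing here applies and the exponential level of p497791 stands.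

* **`WRow.cor312PerImageOf_triple_of_primePow_lt`**, **`WRow.cor312PerImageOf_triple_of_sq_lt`** (`16·abc < l²`),
  **`WRow.cor312PerImageOf_triple_eventually_sqrt`** (`l ≥ 4·Nat.sqrt(abc) + 5`) — `T.Cor312PerImageOf` (reading (P));
* **`WRow.slotLicence_triple_of_primePow_lt`** — the SLOT licence of OUR sharp K-level setting (the γ books' antecedent, negated) for every
  analytic `logv`, every context datum and EVERY pair of realising ideles, at the same primes.

HONEST SCOPE: OUR sharp containers and Dupuy–Hilado's typed (Ind1)/(Ind2); STRONGER-THAN-PRINT readings as labelled in the books; non-emptiness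
of the datum type, admissibility and Szpiro-badness NOT claimed; nothing about the printed GLOBAL inequality or print's own `l`; typed ≠ proved;
instantiated ≠ endorsed; no abc claim. [cite: Mochizuki2012, IUTchI Def. 3.1 (b),(c) pp. 61–62, Ex. 3.2 (iv) p. 71; IUTchIII Cor. 3.12 p. 173–174,
Step (xi-f) p. 184; IUTchIV Thm. 1.10 p. 22, Prop. 1.2 (i)(ii) p. 10, Prop. 1.4 (ii) p. 13, Cor. 2.2 (ii) proof (P5) p. 46] [cite: DupuyHilado2025,
§3.3, §3.9, §4.9, §4.12] [claim: Mochizuki2012, status: disputed] for every IUT sentence. PROOF-ONLY: no definitions.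
-/

noncomputable section

open Set Function NumberField IsDedekindDomain

namespace Summit.ABC.IUTFork.Conditional

open Thm311 Thm311.Real Cor312 Cor312Vol Cor312Prov Literature.IUT.LogThetaLattice Literature.IUT.LogVolume
  Literature.IUT.HodgeTheaters Literature.IUT.LogVolume.ThetaData Literature.IUT.LogVolume.Cor22
open Literature.NumberTheory.NumberFields Literature.NumberTheory.GaloisRepresentations.Ultrametric
open Literature.NumberTheory.DiophantineGeometry Literature.NumberTheory.DiophantineGeometry.GenEll Summit.ABC.ABC.Theorems

/-! ## §1. The per-image Corollary (reading (P)) beyond the sharp level -/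

/-- **`T.Cor312PerImageOf` (READING (P)) at EVERY genuine Θ-datum of EVERY abc triple (`j ≠ 1728`), EVERY prime `l ≥ 5` with
`p < l ∧ 4·p^{⌊v_p(abc)/2⌋} < l` for every odd prime `p ∣ abc`**: p508140's `WRow.cor312Of_triple_of_primePow_lt` (reading (U)) and the
degree-one identity of the two readings (`d_mod (ratPoint _) = 1`; abc-iut-c312-d1 `DHData.cor312Of_iff_perImage_of_finrank_eq_one`).
[cite: Mochizuki2012, IUTchIII Cor. 3.12 p. 173–174; IUTchIV Thm. 1.10 p. 22, Cor. 2.2 (ii) proof (P5) p. 46] [claim: Mochizuki2012, status: disputed] -/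
theorem WRow.cor312PerImageOf_triple_of_primePow_lt {a b c l : ℕ} (habc : IsABCTriple a b c) (hj1728 : Cor22.jInv ((a : ℚ) / c) ≠ 1728)
    (hl : l.Prime) (hl5 : 5 ≤ l)
    (hbad : ∀ p : ℕ, p.Prime → p ∣ a * b * c → p ≠ 2 → p < l ∧ 4 * p ^ ((a * b * c).factorization p / 2) < l)
    (T : Cor22.ThetaVolumeDatumAt (ratPoint ((a : ℚ) / c)) l) : T.Cor312PerImageOf := by
  letI := T.instFieldF; letI := T.instNumberFieldF; letI := T.instAlgebraF; letI := T.instFieldK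
  letI := T.instNumberFieldK; letI := T.instAlgebraK; letI := T.instFieldFbar; letI := T.instAlgebraFbar
  letI := T.instAlgebraKFbar; letI := T.instIsElliptic
  have hF : Module.finrank ℚ (fieldOfModuli T.E) = 1 :=
    T.finrank_rat_fieldOfModuli_eq_dmod.trans (Cor22.dmod_eq_one_of_degree_le_one (le_of_eq (degree_ratPoint _)))
  exact (DHData.cor312Of_iff_perImage_of_finrank_eq_one T.I hF).mp (WRow.cor312Of_triple_of_primePow_lt habc hj1728 hl hl5 hbad T)

/-- **`T.Cor312PerImageOf` (reading (P)) at EVERY genuine Θ-datum of EVERY abc triple (`j ≠ 1728`) at EVERY prime `l` with `16·abc < l²`.**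
[cite: Mochizuki2012, IUTchIII Cor. 3.12 p. 173–174; IUTchIV Thm. 1.10 p. 22] [claim: Mochizuki2012, status: disputed] -/
theorem WRow.cor312PerImageOf_triple_of_sq_lt {a b c l : ℕ} (habc : IsABCTriple a b c) (hj1728 : Cor22.jInv ((a : ℚ) / c) ≠ 1728)
    (hl : l.Prime) (hbig : 16 * (a * b * c) < l ^ 2) (T : Cor22.ThetaVolumeDatumAt (ratPoint ((a : ℚ) / c)) l) : T.Cor312PerImageOf := by
  letI := T.instFieldF; letI := T.instNumberFieldF; letI := T.instAlgebraF; letI := T.instFieldK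
  letI := T.instNumberFieldK; letI := T.instAlgebraK; letI := T.instFieldFbar; letI := T.instAlgebraFbar
  letI := T.instAlgebraKFbar; letI := T.instIsElliptic
  have hF : Module.finrank ℚ (fieldOfModuli T.E) = 1 :=
    T.finrank_rat_fieldOfModuli_eq_dmod.trans (Cor22.dmod_eq_one_of_degree_le_one (le_of_eq (degree_ratPoint _)))
  exact (DHData.cor312Of_iff_perImage_of_finrank_eq_one T.I hF).mp (WRow.cor312Of_triple_of_sq_lt habc hj1728 hl hbig T)

/-- **COFINITENESS IN `l` AT A POLYNOMIAL LEVEL (reading (P))**: for every abc triple with `j(a/c) ≠ 1728`, `T.Cor312PerImageOf` at every genuine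
Θ-datum of `(a/c, l)` for every prime `l ≥ 4·Nat.sqrt(abc) + 5` — against the level `exp((2/3)·log q^{∤2}(λ))` of p497791 at degree one.
[cite: Mochizuki2012, IUTchIII Cor. 3.12 p. 173–174; IUTchIV Thm. 1.10 p. 22] [claim: Mochizuki2012, status: disputed] -/
theorem WRow.cor312PerImageOf_triple_eventually_sqrt {a b c : ℕ} (habc : IsABCTriple a b c) (hj1728 : Cor22.jInv ((a : ℚ) / c) ≠ 1728) :
    ∀ l : ℕ, l.Prime → 4 * Nat.sqrt (a * b * c) + 5 ≤ l → ∀ T : Cor22.ThetaVolumeDatumAt (ratPoint ((a : ℚ) / c)) l, T.Cor312PerImageOf := by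
  intro l hl hL T
  letI := T.instFieldF; letI := T.instNumberFieldF; letI := T.instAlgebraF; letI := T.instFieldK
  letI := T.instNumberFieldK; letI := T.instAlgebraK; letI := T.instFieldFbar; letI := T.instAlgebraFbar
  letI := T.instAlgebraKFbar; letI := T.instIsElliptic
  have hF : Module.finrank ℚ (fieldOfModuli T.E) = 1 :=
    T.finrank_rat_fieldOfModuli_eq_dmod.trans (Cor22.dmod_eq_one_of_degree_le_one (le_of_eq (degree_ratPoint _)))
  exact (DHData.cor312Of_iff_perImage_of_finrank_eq_one T.I hF).mp (WRow.cor312Of_triple_eventually_sqrt habc hj1728 l hl hL T)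

/-! ## §2. The slot licence (the γ books' antecedent) beyond the sharp level -/

/-- **THE SLOT LICENCE of OUR sharp K-level setting at EVERY genuine Θ-datum of EVERY abc triple (`j ≠ 1728`), EVERY prime `l ≥ 5` with
`p < l ∧ 4·p^{⌊v_p(abc)/2⌋} < l` for every odd prime `p ∣ abc`**, for every analytic `logv`, every context datum and EVERY pair of REALISING
Θ- and q-ideles: p508140's `WRow.licence_triple_of_primePow_lt` ((U) licence) and the degree-one identity of slot and union licences for
realising ideles (`Cor312Prov.slotLicence_iff_licence_settingPrVolSharp_pilotDataOfK_of_finrank_eq_one_of_isVolumeInputOf`). So at such data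
the γ books' antecedent `¬ SlotLicence` (at the chosen realising ideles) is FALSE. [cite: Mochizuki2012, IUTchI Def. 3.1 (b),(c) pp. 61–62;
IUTchIII Cor. 3.12 Step (xi-f) p. 184; IUTchIV Prop. 1.2 (i)(ii) p. 10, Prop. 1.4 (ii) p. 13] [cite: DupuyHilado2025, §3.3, §3.9, §4.9, §4.12]
[claim: Mochizuki2012, status: disputed] -/
theorem WRow.slotLicence_triple_of_primePow_lt {a b c l : ℕ} (habc : IsABCTriple a b c) (hj1728 : Cor22.jInv ((a : ℚ) / c) ≠ 1728)
    (hl : l.Prime) (hl5 : 5 ≤ l)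
    (hbad : ∀ p : ℕ, p.Prime → p ∣ a * b * c → p ≠ 2 → p < l ∧ 4 * p ^ ((a * b * c).factorization p / 2) < l)
    (T : Cor22.ThetaVolumeDatumAt (ratPoint ((a : ℚ) / c)) l) :
    letI := T.instFieldF; letI := T.instNumberFieldF; letI := T.instAlgebraF; letI := T.instFieldK
    letI := T.instNumberFieldK; letI := T.instAlgebraK; letI := T.instFieldFbar; letI := T.instAlgebraFbar
    letI := T.instAlgebraKFbar; letI := T.instIsElliptic
    ∀ {logv : PadicLogs T.K} (hlog : LogvAnalytic logv) (M : Type) [Field M] [NumberField M]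
      (archPk : ∀ (j : (thetaIndex (pilotDataOfK T.D T.K)).Label) (vQ : (thetaIndex (pilotDataOfK T.D T.K)).VQ),
        Set ((logShellsDH (pilotDataOfK T.D T.K) logv).Packet j vQ))
      (archSub : ∀ (j : (thetaIndex (pilotDataOfK T.D T.K)).Label) (v : (thetaIndex (pilotDataOfK T.D T.K)).V),
        Set ((logShellsDH (pilotDataOfK T.D T.K) logv).Packet j ((thetaIndex (pilotDataOfK T.D T.K)).over v)))
      (Ψ : ℤ → ∀ v : (thetaIndex (pilotDataOfK T.D T.K)).V, v ∈ (thetaIndex (pilotDataOfK T.D T.K)).Vbad →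
        Set ((logShellsDH (pilotDataOfK T.D T.K) logv).StarPacket v))
      (act : ℤ → ∀ v : (thetaIndex (pilotDataOfK T.D T.K)).V, v ∈ (thetaIndex (pilotDataOfK T.D T.K)).Vbad →
        (logShellsDH (pilotDataOfK T.D T.K) logv).StarPacket v → Module.End ℚ ((logShellsDH (pilotDataOfK T.D T.K) logv).StarPacket v))
      (Mmod : ℤ → ∀ j : (thetaIndex (pilotDataOfK T.D T.K)).LabelStar, Set ((logShellsDH (pilotDataOfK T.D T.K) logv).GlobalPacket j.1))
      (region : ℤ → ∀ j : (thetaIndex (pilotDataOfK T.D T.K)).LabelStar, FinDivisor M → ∀ vQ : (thetaIndex (pilotDataOfK T.D T.K)).VQ,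
        Set ((logShellsDH (pilotDataOfK T.D T.K) logv).Packet j.1 vQ))
      (n : ℤ) {HT : Type} {LogLink : HT → HT → Type} {IsFull : ∀ {s t : HT}, LogLink s t → Prop}
      (lat : LGPGaussianLogThetaLattice LogLink IsFull)
      {Frd : Type} {IsoF : Frd → Frd → Type} {Ob : Frd → Type} {realify : Frd → Frd} {Strip : Type}
      {IsoS : Strip → Strip → Type} {Mv : ∀ v : (thetaIndex (pilotDataOfK T.D T.K)).V, v ∈ (thetaIndex (pilotDataOfK T.D T.K)).Vbad → Type}
      [∀ v h, Monoid (Mv v h)]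
      (sig : GlobalLGPFrobenioidSignature (thetaIndex (pilotDataOfK T.D T.K)).lstar (thetaIndex (pilotDataOfK T.D T.K)).V
        (· ∈ (thetaIndex (pilotDataOfK T.D T.K)).Vbad) Frd IsoF Ob realify Strip IsoS Mv)
      (split : SplittingMonoids Mv) {ObΔ : Type} {N : ∀ v : (thetaIndex (pilotDataOfK T.D T.K)).V, v ∈ (thetaIndex (pilotDataOfK T.D T.K)).Vbad → Type}
      [∀ v h, Monoid (N v h)] (qData : QPilotData ObΔ N)
      (tq : ∀ (pp : Nat.Primes) (x : (thetaIndex (pilotDataOfK T.D T.K)).Fibre (.inr pp)),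
        haveI : Fact (pp : ℕ).Prime := ⟨pp.2⟩; kOf (pilotDataOfK T.D T.K) pp.1 x)
      (t : ∀ (pp : Nat.Primes) (_ : Fin (pilotDataOfK T.D T.K).lstar) (x : (thetaIndex (pilotDataOfK T.D T.K)).Fibre (.inr pp)),
        haveI : Fact (pp : ℕ).Prime := ⟨pp.2⟩; kOf (pilotDataOfK T.D T.K) pp.1 x)
      (htq0 : ∀ pp x, tq pp x ≠ 0)
      (htq1 : ∀ (pp : Nat.Primes) (x : (thetaIndex (pilotDataOfK T.D T.K)).Fibre (.inr pp)),
        haveI : Fact (pp : ℕ).Prime := ⟨pp.2⟩; placeOf (pilotDataOfK T.D T.K) pp.1 x ∉ (pilotDataOfK T.D T.K).S → ‖tq pp x‖ = 1)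
      (_ht0 : ∀ pp i x, t pp i x ≠ 0)
      (_ht : ∀ (pp : Nat.Primes) (i : Fin (pilotDataOfK T.D T.K).lstar) (x : (thetaIndex (pilotDataOfK T.D T.K)).Fibre (.inr pp)),
        haveI : Fact (pp : ℕ).Prime := ⟨pp.2⟩
        Real.log ‖t pp i x‖ = -((pilotDataOfK T.D T.K).thetaPilot i (placeOf (pilotDataOfK T.D T.K) pp.1 x)) *
          logNorm T.K (placeOf (pilotDataOfK T.D T.K) pp.1 x) / localDegree T.K (placeOf (pilotDataOfK T.D T.K) pp.1 x))
      (_htq : ∀ (pp : Nat.Primes) (x : (thetaIndex (pilotDataOfK T.D T.K)).Fibre (.inr pp)),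
        haveI : Fact (pp : ℕ).Prime := ⟨pp.2⟩
        Real.log ‖tq pp x‖ = -((pilotDataOfK T.D T.K).qPilot (placeOf (pilotDataOfK T.D T.K) pp.1 x)) *
          logNorm T.K (placeOf (pilotDataOfK T.D T.K) pp.1 x) / localDegree T.K (placeOf (pilotDataOfK T.D T.K) pp.1 x)),
      (settingPrVolSharp (pilotDataOfK T.D T.K) hlog M archPk archSub Ψ act Mmod region n lat sig split qData tq t htq0 htq1).SlotLicence := by
  letI := T.instFieldF; letI := T.instNumberFieldF; letI := T.instAlgebraF; letI := T.instFieldK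
  letI := T.instNumberFieldK; letI := T.instAlgebraK; letI := T.instFieldFbar; letI := T.instAlgebraFbar
  letI := T.instAlgebraKFbar; letI := T.instIsElliptic
  intro logv hlog M _ _ archPk archSub Ψ act Mmod region n HT LogLink IsFull lat Frd IsoF Ob realify Strip IsoS Mv _ sig split ObΔ N _
    qData tq t htq0 htq1 ht0 ht htq
  have hF : Module.finrank ℚ (fieldOfModuli T.E) = 1 :=
    T.finrank_rat_fieldOfModuli_eq_dmod.trans (Cor22.dmod_eq_one_of_degree_le_one (le_of_eq (degree_ratPoint _)))
  exact (Cor312Prov.slotLicence_iff_licence_settingPrVolSharp_pilotDataOfK_of_finrank_eq_one_of_isVolumeInputOf T.D t hlog M archPk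
    archSub Ψ act Mmod region n lat sig split qData tq htq0 htq1 T.isVolumeInputOf ht0 ht hF).2
    (WRow.licence_triple_of_primePow_lt habc hj1728 hl hl5 hbad T hlog M archPk archSub Ψ act Mmod region n lat sig split qData tq t htq0
      htq1 ht0 ht htq)

end Summit.ABC.IUTFork.Conditional

end
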